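import Summits.QuantumFields.BalabanUV.T4Continuum.Support.NE9BirthInsertion

/-!
# NE9BirthCouplingTwoPoint — route P3's BIRTH supplier carried to the shape the row owner's bridge consumes: for the
one-block model activity normalised by the REAL Gaussian normalisation, the insertion bound of `NE9BirthInsertion` plus the
mean value theorem in the coupling `t` give the COUPLING TWO-POINT clause «size ≤ N and difference ≤ clip·|t − t′|·N under a
cross-uniform majorant N» — the pattern of the binder `hCup` of `Support/NE9LastCouplingBridge.norm_newTerm_sub_le_of_
couplingTwoPoint` (row NE9 owner, t4-ne9-p1) — in t-currency, at REAL coupling, with NO cut-off shell and NO dilated tables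
(cell `pub-balaban`, node U3 / NE9; BINDER row NE9 co-owner #3, unit `b2b-balaban-t4-ne9-p3`; skeleton
`HOME/t4/skeletons/NE9-t4-ne9-p3.md` leaf L4, supplier (a), second half of item F-P3-1)

HONEST FRAMING (T4-DAG PAGE 1).  Rung (B)+1 on a FIXED finite torus; NOT infinite volume, NOT the mass gap, NOT Clay.  NE9 is
NOT PRINTED and is NOT discharged here: this is real analysis on the ONE-BLOCK MODEL objects of the tree leaf
`T4ComplexDilation` (reference measure `μ` carrying the coupling-free cut-off, coupling-free density `f`, real action
density `S ≥ 0` carrying the coupling LINEARLY in the exponent — the structure of the unscaled variables B′ of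
[Balaban1987RG1] (2.10) p. 267 with the cut-off (2.9) p. 266, named for STRUCTURE only).  OUR OWN WORK (Summits side);
[folklore] throughout; asserts nothing about Bałaban's objects; spine 0/9 unchanged.

WHAT IS PROVED.
* §1 `realNorm A r = ‖N_A(r)‖⁻¹` in CLOSED FORM `√(det A/(2π)ⁿ)·√(rⁿ)` (from the tree's `norm_gaussNorm_sq_mul`) and its
  derivative along the reals: `r·ν′(r) = (n/2)·ν(r)` — the normalisation's own coupling dependence is the background-free
  factor `r^{n/2}` ([Balaban1987RG1] (2.14) «log N_k″ = 𝐄^{(k+1)}(g_k, 1)» cancels it in print; here it is simply carried).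
* §2 the REAL-normalised model activity `actR A μ f S r = ν_A(r)·∫ f e^{−rS} dμ`: differentiable in `r > 0` with
  `‖r·actR′(r)‖ ≤ (n/2)·absAct(r) + (eθ)⁻¹·√((1−θ)ⁿ)⁻¹·absAct((1−θ)r)` (§1 + `NE9BirthInsertion.norm_invNorm_mul_insertion_le`).
* §3 **`couplingTwoPoint_of_insertion`**: if the printed-TYPE absolute-value functional is bounded UNIFORMLY on the dilated
  coupling range, `absAct(r) ≤ N` for `r ≥ (1−θ)t₀` (TYPE: [Balaban1988RG2Cluster] Lemma 3 (2.38) is uniform in the coupling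
  of the window), then for `t, t′ ≥ t₀`: `‖actR(t)‖ ≤ N` and `‖actR(t) − actR(t′)‖ ≤ (K/t₀)·N·|t − t′|` with
  `K = n/2 + (eθ)⁻¹√((1−θ)ⁿ)⁻¹` — the `hCup` pattern with `clip = K/t₀` (mean value theorem on the convex ray `[t₀, ∞)`).
WHAT IS NOT HERE: the instantiation on the (2.14)-FORM activities of [Balaban1988RG2Cluster] (the prefactor/table structure
`pre·exp(lin Q)` goes into `f`, coupling-free in the B′-picture; the vertex terms `t·V(H₁B′)` go into `S`) — skeleton item
O2; the absorption of `√((1−θ)ⁿ)⁻¹ ≤ e^{nθ/(2(1−θ))}` by (2.30).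

References (STRUCTURE only): [Balaban1987RG1] CMP **109** (1987), (2.9)–(2.14) pp. 266–268; [Balaban1988RG2Cluster] CMP **116**
(1988), (2.15) p. 15, (2.30) p. 18, Lemma 3 (2.38) p. 20.
-/

noncomputable section

namespace Summit.QuantumFields.BalabanUV.T4Continuum.NE9BirthCouplingTwoPoint

open MeasureTheory Complex Set
open Literature.MathematicalPhysics.QuantumFieldTheory.Balaban1983to89.T4ComplexDilation
open Summit.QuantumFields.BalabanUV.T4Continuum.NE9BirthInsertion

variable {ι : Type*} [Fintype ι] [DecidableEq ι] {X : Type*} [MeasurableSpace X]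

/-! ## §1 The real normalisation in closed form and its derivative -/

/-- The REAL inverse Gaussian normalisation `ν_A(r) = ‖N_A(r)‖⁻¹`. [folklore] -/
def realNorm (A : Matrix ι ι ℝ) (r : ℝ) : ℝ := ‖gaussNorm A (r : ℂ)‖⁻¹

omit [DecidableEq ι] in
/-- `ν_A(r) ≥ 0`. [folklore] -/
theorem realNorm_nonneg (A : Matrix ι ι ℝ) (r : ℝ) : 0 ≤ realNorm A r := inv_nonneg.2 (norm_nonneg _)

/-- CLOSED FORM: `ν_A(r) = √(det A/(2π)ⁿ)·√(rⁿ)` for `A ≻ 0`, `r > 0` (from `‖N_A(r)‖²·rⁿ·det A = (2π)ⁿ`). [folklore] -/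
theorem realNorm_eq (A : Matrix ι ι ℝ) (hA : A.PosDef) {r : ℝ} (hr : 0 < r) :
    realNorm A r = Real.sqrt (A.det / (2 * Real.pi) ^ Fintype.card ι) * Real.sqrt (r ^ Fintype.card ι) := by
  set n := Fintype.card ι
  have hre : 0 < ((r : ℝ) : ℂ).re := by simpa using hr
  have h := norm_gaussNorm_sq_mul A hA hre
  rw [Complex.norm_real, Real.norm_of_nonneg hr.le] at h
  have hN : 0 < ‖gaussNorm A (r : ℂ)‖ := norm_pos_iff.2 (gaussNorm_ne_zero A hA hre)
  have hdet : 0 < A.det := hA.det_pos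
  have h2π : 0 < (2 * Real.pi) ^ n := by positivity
  have hrn : 0 < r ^ n := pow_pos hr n
  unfold realNorm
  have hsq : (‖gaussNorm A (r : ℂ)‖⁻¹) ^ 2 = A.det / (2 * Real.pi) ^ n * r ^ n := by
    rw [inv_pow]
    refine inv_eq_iff_eq_inv.2 ?_
    rw [← one_div, eq_div_iff (by positivity : A.det / (2 * Real.pi) ^ n * r ^ n ≠ 0)]
    field_simp
    linear_combination h
  calc ‖gaussNorm A (r : ℂ)‖⁻¹ = Real.sqrt ((‖gaussNorm A (r : ℂ)‖⁻¹) ^ 2) :=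
        (Real.sqrt_sq (inv_nonneg.2 hN.le)).symm
    _ = Real.sqrt (A.det / (2 * Real.pi) ^ n * r ^ n) := by rw [hsq]
    _ = Real.sqrt (A.det / (2 * Real.pi) ^ n) * Real.sqrt (r ^ n) := Real.sqrt_mul (div_nonneg hdet.le h2π.le) _

/-- **Derivative of the real normalisation**: for `A ≻ 0`, `r > 0`, `ν_A` has derivative `(n/(2r))·ν_A(r)` at `r`, i.e.
`r·ν′(r) = (n/2)·ν(r)` — the coupling dependence of the Gaussian normalisation is the background-free factor `r^{n/2}`.
[folklore] -/
theorem hasDerivAt_realNorm (A : Matrix ι ι ℝ) (hA : A.PosDef) {r : ℝ} (hr : 0 < r) :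
    HasDerivAt (realNorm A) ((Fintype.card ι : ℝ) / (2 * r) * realNorm A r) r := by
  -- on the positive reals `realNorm A = c·√(·ⁿ)` with `c = √(det A/(2π)ⁿ)`
  have heq : (fun s => Real.sqrt (A.det / (2 * Real.pi) ^ Fintype.card ι) * Real.sqrt (s ^ Fintype.card ι))
      =ᶠ[nhds r] realNorm A := by
    filter_upwards [Ioi_mem_nhds hr] with s hs
    exact (realNorm_eq A hA hs).symm
  have hrn : r ^ Fintype.card ι ≠ 0 := (pow_pos hr _).ne'
  have hpow : HasDerivAt (fun s : ℝ => s ^ Fintype.card ι)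
      ((Fintype.card ι : ℝ) * r ^ (Fintype.card ι - 1)) r := hasDerivAt_pow _ r
  have hsqrt := (hpow.sqrt hrn).const_mul (Real.sqrt (A.det / (2 * Real.pi) ^ Fintype.card ι))
  refine (hsqrt.congr_of_eventuallyEq heq.symm).congr_deriv ?_
  -- algebra: c·(n r^{n-1} / (2√(rⁿ))) = (n/(2r))·(c·√(rⁿ))
  rw [realNorm_eq A hA hr]
  have hsr : 0 < Real.sqrt (r ^ Fintype.card ι) := Real.sqrt_pos.2 (pow_pos hr _)
  have hrr : Real.sqrt (r ^ Fintype.card ι) * Real.sqrt (r ^ Fintype.card ι) = r ^ Fintype.card ι :=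
    Real.mul_self_sqrt (pow_pos hr _).le
  rcases Nat.eq_zero_or_pos (Fintype.card ι) with hn | hn
  · simp [hn]
  · have hpow' : r ^ Fintype.card ι = r * r ^ (Fintype.card ι - 1) := by
      rw [← pow_succ']; congr 1; omega
    have key : (r ^ (Fintype.card ι - 1) : ℝ) / (2 * Real.sqrt (r ^ Fintype.card ι)) =
        Real.sqrt (r ^ Fintype.card ι) / (2 * r) := by
      rw [div_eq_div_iff (by positivity) (by positivity)]
      calc r ^ (Fintype.card ι - 1) * (2 * r) = 2 * (r * r ^ (Fintype.card ι - 1)) := by ring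
        _ = 2 * r ^ Fintype.card ι := by rw [← hpow']
        _ = 2 * (Real.sqrt (r ^ Fintype.card ι) * Real.sqrt (r ^ Fintype.card ι)) := by rw [hrr]
        _ = Real.sqrt (r ^ Fintype.card ι) * (2 * Real.sqrt (r ^ Fintype.card ι)) := by ring
    rw [mul_div_assoc, key]
    ring

/-! ## §2 The real-normalised model activity and the bound on `r·∂_r` -/

/-- The REAL-normalised one-block activity `actR(r) = ν_A(r)·∫ f e^{−rS} dμ` (real coupling `r`; the sibling's `act` uses the
holomorphic branch `invNorm` instead — same modulus). [folklore] -/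
def actR (A : Matrix ι ι ℝ) (μ : Measure X) (f : X → ℂ) (S : X → ℝ) (r : ℝ) : ℂ :=
  (realNorm A r : ℂ) * blockInt μ f S (r : ℂ)

omit [DecidableEq ι] in
/-- `‖actR(r)‖ ≤ absAct(r)` — the printed-type absolute-value functional dominates the activity (tree `norm_blockInt_le`).
[folklore] -/
theorem norm_actR_le (A : Matrix ι ι ℝ) (μ : Measure X) (f : X → ℂ) (S : X → ℝ) (r : ℝ) :
    ‖actR A μ f S r‖ ≤ absAct A μ f S r := by
  unfold actR absAct realNorm
  rw [norm_mul, Complex.norm_real, Real.norm_of_nonneg (inv_nonneg.2 (norm_nonneg _))]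
  refine mul_le_mul_of_nonneg_left ?_ (inv_nonneg.2 (norm_nonneg _))
  simpa using norm_blockInt_le μ f S (r : ℂ)

/-- The derivative of the real-normalised activity (product rule: §1 × `NE9BirthInsertion.hasDerivAt_blockInt_real`).
[folklore] -/
theorem hasDerivAt_actR (A : Matrix ι ι ℝ) (hA : A.PosDef) {μ : Measure X} {f : X → ℂ} (hf : Integrable f μ)
    {S : X → ℝ} (hS : Measurable S) {S₀ : ℝ} (hS₀ : ∀ x, |S x| ≤ S₀) {r : ℝ} (hr : 0 < r) :
    HasDerivAt (actR A μ f S)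
      ((((Fintype.card ι : ℝ) / (2 * r) * realNorm A r : ℝ) : ℂ) * blockInt μ f S (r : ℂ) +
        (realNorm A r : ℂ) * insertion μ f S r) r := by
  have h1 : HasDerivAt (fun s : ℝ => (realNorm A s : ℂ))
      ((((Fintype.card ι : ℝ) / (2 * r) * realNorm A r : ℝ) : ℂ)) r :=
    (hasDerivAt_realNorm A hA hr).ofReal_comp
  exact h1.mul (hasDerivAt_blockInt_real μ hf hS hS₀ r)

/-- **`‖r·actR′(r)‖ ≤ (n/2)·absAct(r) + (eθ)⁻¹·√((1−θ)ⁿ)⁻¹·absAct((1−θ)r)`**: the normalisation contributes the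
background-free `n/2`, the Boltzmann weight the dominated insertion (`NE9BirthInsertion.norm_invNorm_mul_insertion_le`).
[folklore] -/
theorem norm_mul_deriv_actR_le (A : Matrix ι ι ℝ) (hA : A.PosDef) {μ : Measure X} {f : X → ℂ} (hf : Integrable f μ)
    {S : X → ℝ} (hSm : Measurable S) (hS : ∀ x, 0 ≤ S x) {θ : ℝ} (hθ : 0 < θ) (hθ1 : θ < 1) {r : ℝ} (hr : 0 < r) :
    ‖(r : ℂ) * ((((Fintype.card ι : ℝ) / (2 * r) * realNorm A r : ℝ) : ℂ) * blockInt μ f S (r : ℂ) +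
        (realNorm A r : ℂ) * insertion μ f S r)‖ ≤
      (Fintype.card ι : ℝ) / 2 * absAct A μ f S r +
        (Real.exp 1 * θ)⁻¹ * Real.sqrt (((1 - θ) ^ Fintype.card ι)⁻¹) * absAct A μ f S ((1 - θ) * r) := by
  set n := Fintype.card ι
  have hν : 0 ≤ realNorm A r := realNorm_nonneg A r
  rw [mul_add]
  refine (norm_add_le _ _).trans (add_le_add ?_ ?_)
  · have e : (r : ℂ) * ((((n : ℝ) / (2 * r) * realNorm A r : ℝ) : ℂ) * blockInt μ f S (r : ℂ)) =
        (((n : ℝ) / 2 * realNorm A r : ℝ) : ℂ) * blockInt μ f S (r : ℂ) := by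
      have hr' : (r : ℂ) ≠ 0 := by exact_mod_cast hr.ne'
      rw [← mul_assoc]
      congr 1
      push_cast
      field_simp
    rw [e, norm_mul, Complex.norm_real, Real.norm_of_nonneg (by positivity)]
    have hI : ‖blockInt μ f S (r : ℂ)‖ ≤ ∫ x, ‖f x‖ * Real.exp (-(r * S x)) ∂μ := by
      simpa using norm_blockInt_le μ f S (r : ℂ)
    calc (n : ℝ) / 2 * realNorm A r * ‖blockInt μ f S (r : ℂ)‖
        ≤ (n : ℝ) / 2 * realNorm A r * ∫ x, ‖f x‖ * Real.exp (-(r * S x)) ∂μ :=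
          mul_le_mul_of_nonneg_left hI (by positivity)
      _ = (n : ℝ) / 2 * absAct A μ f S r := by unfold absAct realNorm; ring
  · have hre : 0 < ((r : ℝ) : ℂ).re := by simpa using hr
    rw [mul_left_comm, norm_mul, Complex.norm_real, Real.norm_of_nonneg hν]
    unfold realNorm
    rw [← norm_invNorm_eq_inv A hA hre]
    exact norm_invNorm_mul_insertion_le A hA hf hSm hS hθ hθ1 hr

/-! ## §3 The coupling two-point clause from the insertion bound (mean value theorem in `t`) -/

/-- The insertion-route constant `K(θ, n) = n/2 + (eθ)⁻¹·√((1−θ)ⁿ)⁻¹`. [folklore] -/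
def birthConst (θ : ℝ) (n : ℕ) : ℝ := (n : ℝ) / 2 + (Real.exp 1 * θ)⁻¹ * Real.sqrt (((1 - θ) ^ n)⁻¹)

/-- `K(θ, n) ≥ 0` for `θ > 0`. [folklore] -/
theorem birthConst_nonneg {θ : ℝ} (hθ : 0 < θ) (n : ℕ) : 0 ≤ birthConst θ n := by
  unfold birthConst; positivity

/-- **COUPLING TWO-POINT FROM THE INSERTION BOUND (the `hCup` pattern, t-currency, REAL coupling, no shell).**  If the
printed-TYPE absolute-value functional is bounded UNIFORMLY on the dilated coupling range, `absAct(r) ≤ N` for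
`r ≥ (1−θ)t₀`, then for all `t, t′ ≥ t₀`:  `‖actR(t)‖ ≤ N` and `‖actR(t) − actR(t′)‖ ≤ (K(θ,n)/t₀)·N·|t − t′|` — size and
two-point difference under ONE cross-uniform majorant, with `clip = K(θ,n)/t₀`, by the mean value theorem on the convex ray
`[t₀, ∞)` applied to §2. [folklore] -/
theorem couplingTwoPoint_of_insertion (A : Matrix ι ι ℝ) (hA : A.PosDef) {μ : Measure X} {f : X → ℂ}
    (hf : Integrable f μ) {S : X → ℝ} (hSm : Measurable S) (hS : ∀ x, 0 ≤ S x) {S₀ : ℝ} (hS₀ : ∀ x, |S x| ≤ S₀)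
    {θ : ℝ} (hθ : 0 < θ) (hθ1 : θ < 1) {t₀ : ℝ} (ht₀ : 0 < t₀) {N : ℝ}
    (habs : ∀ r, (1 - θ) * t₀ ≤ r → absAct A μ f S r ≤ N) {t t' : ℝ} (ht : t₀ ≤ t) (ht' : t₀ ≤ t') :
    ‖actR A μ f S t‖ ≤ N ∧
      ‖actR A μ f S t - actR A μ f S t'‖ ≤ birthConst θ (Fintype.card ι) / t₀ * N * |t - t'| := by
  set n := Fintype.card ι
  have hdil : ∀ {r}, t₀ ≤ r → (1 - θ) * t₀ ≤ r := fun {r} hr => by nlinarith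
  have hN : 0 ≤ N := (absAct_nonneg A μ f S t).trans (habs t (hdil ht))
  refine ⟨(norm_actR_le A μ f S t).trans (habs t (hdil ht)), ?_⟩
  -- derivative bound on the ray
  have hderiv : ∀ r ∈ Ici t₀, HasDerivWithinAt (actR A μ f S)
      ((((n : ℝ) / (2 * r) * realNorm A r : ℝ) : ℂ) * blockInt μ f S (r : ℂ) +
        (realNorm A r : ℂ) * insertion μ f S r) (Ici t₀) r := fun r hr =>
    (hasDerivAt_actR A hA hf hSm hS₀ (ht₀.trans_le hr)).hasDerivWithinAt
  have hbound : ∀ r ∈ Ici t₀, ‖(((n : ℝ) / (2 * r) * realNorm A r : ℝ) : ℂ) * blockInt μ f S (r : ℂ) +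
      (realNorm A r : ℂ) * insertion μ f S r‖ ≤ birthConst θ n / t₀ * N := by
    intro r hr
    have hr0 : 0 < r := ht₀.trans_le hr
    have h := norm_mul_deriv_actR_le A hA hf hSm hS hθ hθ1 hr0
    rw [norm_mul, Complex.norm_real, Real.norm_of_nonneg hr0.le] at h
    have h1 : absAct A μ f S r ≤ N := habs r (hdil hr)
    have h2 : absAct A μ f S ((1 - θ) * r) ≤ N :=
      habs _ (mul_le_mul_of_nonneg_left (mem_Ici.1 hr) (by linarith))
    have hK : (n : ℝ) / 2 * absAct A μ f S r +
        (Real.exp 1 * θ)⁻¹ * Real.sqrt (((1 - θ) ^ n)⁻¹) * absAct A μ f S ((1 - θ) * r) ≤ birthConst θ n * N := by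
      have hC : 0 ≤ (Real.exp 1 * θ)⁻¹ * Real.sqrt (((1 - θ) ^ n)⁻¹) := by positivity
      have hn0 : (0 : ℝ) ≤ (n : ℝ) / 2 := by positivity
      calc (n : ℝ) / 2 * absAct A μ f S r +
            (Real.exp 1 * θ)⁻¹ * Real.sqrt (((1 - θ) ^ n)⁻¹) * absAct A μ f S ((1 - θ) * r)
          ≤ (n : ℝ) / 2 * N + (Real.exp 1 * θ)⁻¹ * Real.sqrt (((1 - θ) ^ n)⁻¹) * N :=
            add_le_add (mul_le_mul_of_nonneg_left h1 hn0) (mul_le_mul_of_nonneg_left h2 hC)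
        _ = birthConst θ n * N := by unfold birthConst; ring
    -- ‖D‖ ≤ K N / r ≤ K N / t₀
    have hD : ‖(((n : ℝ) / (2 * r) * realNorm A r : ℝ) : ℂ) * blockInt μ f S (r : ℂ) +
        (realNorm A r : ℂ) * insertion μ f S r‖ ≤ birthConst θ n * N / r := by
      rw [le_div_iff₀ hr0, mul_comm]
      exact h.trans hK
    refine hD.trans ?_
    rw [div_mul_eq_mul_div]
    exact div_le_div_of_nonneg_left (mul_nonneg (birthConst_nonneg hθ n) hN) ht₀ hr
  have key := (convex_Ici t₀).norm_image_sub_le_of_norm_hasDerivWithin_le hderiv hbound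
    (mem_Ici.2 ht') (mem_Ici.2 ht)
  rwa [Real.norm_eq_abs] at key

end Summit.QuantumFields.BalabanUV.T4Continuum.NE9BirthCouplingTwoPoint

end
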